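import Literature.Computability.AlgebraicComplexity.BI17FundamentalInvariantForms
import HarnessLib

/-!
# Popov's stability criterion, as invoked by Bürgisser–Ikenmeyer 2017 (forms under `SL_m`)

[topic Computability/AlgebraicComplexity]

Bürgisser–Ikenmeyer, *Fundamental invariants of orbit closures* (J. Algebra 477 (2017) =
arXiv:1511.02927), proof of Prop. 2.10 (TeX `main.tex` L644–651 = `paper:arxiv-1511.02927`
p0007.txt:L71–78), verbatim: "Now assume `D > 2`. Theorem 2.3 tells us that `stab(w)` is finite for
almost all `w ∈ Sym^D ℂ^m`. A general result due to Luna [Lun73], see also [Kra84, II 4.3D, Folgerung,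
p. 142], implies that `SL_m w` is closed for almost all `w` if `SL_m ∩ stab(w)` is finite for almost
all `w`. (This general result only requires that `SL_m` is a semisimple group.) Hence, almost all
`w ∈ Sym^D ℂ^m` are polystable."

The "general result" is POPOV'S STABILITY CRITERION (V. L. Popov 1970 [Popov1970]; printed locus as
cited by BI: H. Kraft, *Geometrische Methoden in der Invariantentheorie* (1984), II.4.3.D Folgerung,
p. 142 [Kraft1984]; the ingredients in D. Luna, *Slices étales*, Mém. SMF 33 (1973) §III.4
"L'isotropie générique", `paper:url-52d244a6929f` p0024–p0025): for a connected semisimple group `G`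
acting linearly on a finite-dimensional complex vector space `V`, if the stabiliser `G_v` is finite
for all `v` in a nonempty Zariski-open subset of `V`, then the orbit `G·v` is closed for all `v` in a
nonempty Zariski-open subset of `V`. Neither [Popov1970] nor [Kraft1984] is held by the cell (lit wants
acq-12121 / acq-12120); the statement below is typed from BI's quotation, as the INSTANCE BI use:
`G = SL_m(ℂ)` (`m ≥ 2`, a semisimple group) acting on `V = Sym^D ℂ^m` by substitution of variables.

Rendering (tree vocabulary only; no new notion): "for almost all `w ∈ Sym^D ℂ^m`, `P(w)`" is the
tree's `IsZariskiGeneric D P` (`BI17FundamentalInvariantForms.lean`: a nonzero polynomial in the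
degree-`D` coefficients off whose zero set `P` holds — for the irreducible affine space `Sym^D ℂ^m`
this is exactly "on a nonempty Zariski-open set"); "`SL_m ∩ stab(w)` is finite" is finiteness of
`{g ∈ SL_m(ℂ) | g·w = w}` (`linSubst`); "`SL_m w` is closed" is the tree's `IsPolystable w`
(`Polystability.lean`, BI Def. 2.7 verbatim: the `SL_m`-orbit is Zariski closed in coefficient
space; no null-cone clause). One named fact, no proof in the tree (an external classical theorem of
invariant theory: étale slices / Rosenlicht quotients are not in Mathlib). Its hypothesis is PROVED
in the tree for `D > 2`, `m ≥ 1` (`isZariskiGeneric_finite_slStabilizer`,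
`BI17FiniteStabilizerLocusProofs.lean`, from BI Thm. 2.3 = `BI2017_thm_2_3_open_holds`), so that
`BI2017_prop_2_10` (and `BI2017_cor_3_17`) reduce to this fact alone (`BI2017_prop_2_10_of_popov`,
sibling proof file). One new named fact BY DESIGN (cell val-lit, lead-bip rulings 2026-08-27 00:52Z /
01:05Z; statement vetted in a 20-minute window by the literature desk: faithful to the criterion as
quoted). The tensor twin (BI TeX L1934–1936: `G_s = SL_m³` on `⊗³ℂ^m`, proof of Prop. 4.10) is reserved
for a sibling statement. Honest framing: a cited classical theorem, typed not proved; VP ≠ VNP is NOT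
proved and nothing here bears on it.

## References

* [BurgisserIkenmeyer2017] P. Bürgisser, C. Ikenmeyer, *Fundamental invariants of orbit closures*,
  J. Algebra 477 (2017) 390–434, proof of Prop. 2.10 (and of Prop. 4.10, TeX L1934–1936, the tensor
  twin).
* [Popov1970] V. L. Popov, *Stability criteria for the action of a semisimple group on a factorial
  manifold*, Izv. Akad. Nauk SSSR 34 (1970) = Math. USSR-Izv. 4 (1970) 527–535.
* [Kraft1984] H. Kraft, *Geometrische Methoden in der Invariantentheorie*, Vieweg (1984), II.4.3.D
  Folgerung, p. 142.
* D. Luna, *Slices étales*, Bull. Soc. Math. France, Mémoire 33 (1973) 81–105, §III.4.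
-/

noncomputable section

namespace Literature.Computability.AlgebraicComplexity

open MvPolynomial

/-- **Popov's stability criterion for `SL_m` on `Sym^D ℂ^m`** (Popov 1970; Kraft 1984 II.4.3.D
Folgerung p. 142), exactly as invoked by Bürgisser–Ikenmeyer 2017 in the proof of Prop. 2.10:
"`SL_m w` is closed for almost all `w` if `SL_m ∩ stab(w)` is finite for almost all `w`. (This general
result only requires that `SL_m` is a semisimple group.)" — for `m ≥ 2` (so that `SL_m(ℂ)` is a
nontrivial semisimple group) and every degree `D`: if almost all forms `w ∈ Sym^D ℂ^m` have a finite
`SL_m`-stabiliser, then almost all forms `w ∈ Sym^D ℂ^m` are polystable (`IsPolystable`: the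
`SL_m`-orbit is Zariski closed, BI Def. 2.7). An instance (`G = SL_m`, `V = Sym^D ℂ^m`) of the
printed theorem; typed, not proved.
[cite: BurgisserIkenmeyer2017, proof of Prop. 2.10 (TeX L646–650; p0007:L73–77), quoting Luna 1973 and Kraft 1984 II.4.3.D]
[cite: Kraft1984, II.4.3.D Folgerung, p. 142]
[cite: Popov1970, stability criterion (main theorem; text not held, acq-12121 — locator via BI 2017's citation of Kraft 1984 II.4.3.D)] -/
def Popov1970_genericClosedOrbit_symPower : Prop :=
  ∀ (D m : ℕ), 2 ≤ m →
    IsZariskiGeneric D (fun f : MvPolynomial (Fin m) ℂ =>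
      {g : Matrix.SpecialLinearGroup (Fin m) ℂ |
        linSubst (Fin m) ℂ (g : Matrix (Fin m) (Fin m) ℂ) f = f}.Finite) →
    IsZariskiGeneric D (IsPolystable : MvPolynomial (Fin m) ℂ → Prop)

/-- Unfolding lemma. [cite: BurgisserIkenmeyer2017, proof of Prop. 2.10] -/
theorem Popov1970_genericClosedOrbit_symPower_iff :
    Popov1970_genericClosedOrbit_symPower ↔
      ∀ (D m : ℕ), 2 ≤ m →
        IsZariskiGeneric D (fun f : MvPolynomial (Fin m) ℂ =>
          {g : Matrix.SpecialLinearGroup (Fin m) ℂ |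
            linSubst (Fin m) ℂ (g : Matrix (Fin m) (Fin m) ℂ) f = f}.Finite) →
        IsZariskiGeneric D (IsPolystable : MvPolynomial (Fin m) ℂ → Prop) :=
  Iff.rfl

end Literature.Computability.AlgebraicComplexity

end
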